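import Mathlib
import HarnessLib
import Literature.Computability.AlgebraicComplexity.ArithCircuit
import Literature.Computability.AlgebraicComplexity.SupportSymmetrisation
import Summits.ValiantsHypothesis.ValiantsHypothesis.Theorems.MonotoneRestorationMonotoneRestorationQPEsymmRowSumsComplexity

/-!
# ValiantsHypothesis / MonotoneRestoration — `MonotoneRestorationQP`, line `Sketch`, D3 (part 1)

Support file for crux item `stmt-ValiantsHypothesis-15886`
(`Summit.ValiantsHypothesis.ValiantsHypothesis.Theses.MonotoneRestoration.MonotoneRestorationQP`),
line `Sketch`, stub `stub_rowScan_rowBlocks` (Theorem δ, the row blocks of the scan program):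
generic bookkeeping for building SUPPORTED STRAIGHT-LINE PROGRAMS (tree `ArithCircuit` gate lists
with a support annotation `K : ℕ → Finset (Fin n)`, the input format of
`SupportSymm.exists_symmetric_circuit_of_supports`) one gate at a time.

* `rowScanGates_step` — the INVARIANT EXTENSION LEMMA: the six hypotheses of the support
  symmetrisation theorem (non-nullary gates, fan-in bound, well-formedness, supports of size
  `≤ 2`, hereditary supports of product gates, invariance of every gate value under the diagonal
  renamings fixing its support pointwise) are preserved when one appends a gate `g` with support
  `S` (`|S| ≤ 2`) whose operands refer to earlier gates, whose value is invariant under the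
  renamings fixing `S`, and, if `g` is a product gate, whose operands are supported inside `S`;
  `rowScanGates_step_hered` — when ALL operands are supported inside `S` the invariance is
  automatic (`rowScanGates_operand_rename`, `rowScanGates_gate_rename`).
* `rowScanGates_iter` — iterating a one-task construction over a finite index type while keeping
  an abstract invariant, the prefix relation, the agreement of the annotations and a table of
  located values (`index < length ∧ K index = support ∧ value = …`); located values persist along
  prefixes (`rowScanGates_getD_eq_of_prefix`).

No definitions: the invariant is kept abstract (`Inv`) in `rowScanGates_iter` and spelled out in
`rowScanGates_step`. The iteration lemma `rowScanGates_iter` is the registered sub-goal this file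
discharges; the stub itself is proved in `…QPRowScanRowBlocks.lean`.

## References

* P. Bürgisser, *Completeness and Reduction in Algebraic Complexity Theory*, Springer 2000,
  Def. 2.1 (straight-line programs).
* A. Dawar, G. Wilsenach, *Symmetric Arithmetic Circuits*, Theory of Computing 21 (2025), §3
  (supports).
-/

-- `Summit.ValiantsHypothesis.ValiantsHypothesis.…` is the tree's mandated single-conjunct layout
-- (Sub = Summit), so the duplicated namespace component is intended.
set_option linter.dupNamespace false

open Literature.Computability.AlgebraicComplexity MvPolynomial

namespace Summit.ValiantsHypothesis.ValiantsHypothesis.Theorems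

/-! ### Lists: appending one gate -/

/-- Reading position `i` of `L ++ [g]`: either a position of `L` or the new last one. [folklore] -/
theorem rowScanGates_getElem?_append_singleton {α : Type*} {L : List α} {g g' : α} {i : ℕ}
    (h : (L ++ [g])[i]? = some g') :
    (i < L.length ∧ L[i]? = some g') ∨ (i = L.length ∧ g' = g) := by
  rcases lt_or_ge i L.length with hi | hi
  · exact Or.inl ⟨hi, by rwa [List.getElem?_append_left hi] at h⟩
  · rw [List.getElem?_append_right hi, List.getElem?_singleton] at h
    by_cases h0 : i - L.length = 0
    · rw [if_pos h0] at h
      exact Or.inr ⟨by omega, (Option.some_injective _ h).symm⟩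
    · rw [if_neg h0] at h
      exact absurd h (by simp)

/-- `RefsBelow` is monotone in the bound. [folklore] -/
theorem rowScanGates_refsBelow_mono {k σ : Type*} {u : ArithCircuit.Operand k σ} {a b : ℕ}
    (h : u.RefsBelow a) (hab : a ≤ b) : u.RefsBelow b := by
  cases u with
  | var _ => trivial
  | const _ => trivial
  | gate j => exact lt_of_lt_of_le (show j < a from h) hab

/-- Updating the annotation at position `m` does not change the support of an operand referring
only to gates `< m`. [folklore] -/
theorem rowScanGates_osupp_update {k : Type*} {n : ℕ} (K : ℕ → Finset (Fin n)) (m : ℕ)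
    (S : Finset (Fin n)) {u : ArithCircuit.Operand k (Fin n × Fin n)} (hu : u.RefsBelow m) :
    SupportSymm.osupp (Function.update K m S) u = SupportSymm.osupp K u := by
  cases u with
  | var _ => rfl
  | const _ => rfl
  | gate j => exact Function.update_of_ne (Nat.ne_of_lt (show j < m from hu)) _ _

/-- Appending gates does not change the values of the earlier gates (Bürgisser 2000, Def. 2.1).
[folklore] -/
theorem rowScanGates_getD_eq_of_prefix {k : Type*} [CommSemiring k] {σ : Type*}
    {L L' : List (ArithCircuit.Gate k σ)} (h : L <+: L') {t : ℕ} (ht : t < L.length) :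
    (ArithCircuit.gateValues L').getD t 0 = (ArithCircuit.gateValues L).getD t 0 := by
  obtain ⟨M, rfl⟩ := h
  obtain ⟨W, hW⟩ := esymmRowSumsCplx_gateValues_prefix L M
  rw [← hW, List.getD_eq_getElem?_getD, List.getD_eq_getElem?_getD,
    List.getElem?_append_left (by rwa [ArithCircuit.gateValues_length])]

/-- Bookkeeping of one appended gate `g` with support `S` at position `|L|`: prefix, agreement
of the annotations below `|L|`, length, and the located new value `g.eval (gateValues L)`.
[folklore] -/
theorem rowScanGates_append {k : Type*} [CommSemiring k] {σ κ : Type*}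
    (L : List (ArithCircuit.Gate k σ)) (K : ℕ → κ) (g : ArithCircuit.Gate k σ) (S : κ) :
    L <+: L ++ [g] ∧ (∀ t < L.length, Function.update K L.length S t = K t) ∧
      (L ++ [g]).length ≤ L.length + 1 ∧ L.length < (L ++ [g]).length ∧
      Function.update K L.length S L.length = S ∧
      (ArithCircuit.gateValues (L ++ [g])).getD L.length 0 =
        g.eval (ArithCircuit.gateValues L) := by
  refine ⟨List.prefix_append _ _, fun t ht => Function.update_of_ne (Nat.ne_of_lt ht) _ _,
    by simp, by simp, Function.update_self _ _ _, ?_⟩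
  rw [ArithCircuit.gateValues_append_singleton, List.getD_eq_getElem?_getD,
    List.getElem?_append_right (by rw [ArithCircuit.gateValues_length]),
    ArithCircuit.gateValues_length, Nat.sub_self, List.getElem?_cons_zero, Option.getD_some]

/-! ### Invariance of gate values under renamings -/

/-- A gate all of whose operands have values fixed by `rename f` has a value fixed by `rename f`
(`rename f` is an algebra map). [folklore] -/
theorem rowScanGates_gate_rename {k : Type*} [CommSemiring k] {σ : Type*} (f : σ → σ)
    (vals : List (MvPolynomial σ k)) (g : ArithCircuit.Gate k σ)
    (h : ∀ u ∈ g.args, rename f (u.eval vals) = u.eval vals) :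
    rename f (g.eval vals) = g.eval vals := by
  cases g with
  | sum args =>
    simp only [ArithCircuit.Gate.eval, map_list_sum, List.map_map]
    congr 1
    refine List.map_congr_left fun a ha => ?_
    rw [Function.comp_apply, map_smul, h a.2 (List.mem_map_of_mem ha)]
  | prod args =>
    simp only [ArithCircuit.Gate.eval, map_list_prod, List.map_map]
    congr 1
    refine List.map_congr_left fun u hu => ?_
    rw [Function.comp_apply, h u hu]

/-- An operand referring to an earlier gate and supported inside `S` has a value fixed by the
diagonal renamings fixing `S` pointwise, provided every earlier gate value is fixed by the
renamings fixing its support. [folklore] -/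
theorem rowScanGates_operand_rename {k : Type*} [CommSemiring k] {n : ℕ}
    (L : List (ArithCircuit.Gate k (Fin n × Fin n))) (K : ℕ → Finset (Fin n))
    (h6 : ∀ (i : ℕ) (σ : Equiv.Perm (Fin n)), i < L.length → (∀ x ∈ K i, σ x = x) →
      rename (fun pq : Fin n × Fin n => (σ pq.1, σ pq.2)) ((ArithCircuit.gateValues L).getD i 0) =
        (ArithCircuit.gateValues L).getD i 0)
    {S : Finset (Fin n)} {u : ArithCircuit.Operand k (Fin n × Fin n)} (hu : u.RefsBelow L.length)
    (huS : SupportSymm.osupp K u ⊆ S) (σ : Equiv.Perm (Fin n)) (hσ : ∀ x ∈ S, σ x = x) :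
    rename (fun pq : Fin n × Fin n => (σ pq.1, σ pq.2)) (u.eval (ArithCircuit.gateValues L)) =
      u.eval (ArithCircuit.gateValues L) := by
  cases u with
  | var pq =>
    have h1 : σ pq.1 = pq.1 := hσ _ (huS (by simp [SupportSymm.osupp]))
    have h2 : σ pq.2 = pq.2 := hσ _ (huS (by simp [SupportSymm.osupp]))
    simp [ArithCircuit.Operand.eval, rename_X, h1, h2]
  | const c => simp [ArithCircuit.Operand.eval]
  | gate j => exact h6 j σ hu fun x hx => hσ x (huS hx)

/-! ### The invariant extension lemma -/

/-- **Invariant extension.** The six hypotheses of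
`SupportSymm.exists_symmetric_circuit_of_supports` (non-nullary gates, fan-in `≤ A`, well formed,
supports of size `≤ 2`, hereditary supports of product gates, gate values invariant under the
diagonal renamings fixing their support pointwise) pass from `(L, K)` to
`(L ++ [g], K[|L| ↦ S])` for a non-nullary gate `g` of fan-in `≤ A` referring to gates `< |L|`,
with `|S| ≤ 2`, operands supported inside `S` if `g` is a product gate, and value invariant
under the renamings fixing `S` pointwise. [folklore] -/
theorem rowScanGates_step {k : Type*} [CommSemiring k] {n : ℕ} (A : ℕ)
    (L : List (ArithCircuit.Gate k (Fin n × Fin n))) (K : ℕ → Finset (Fin n))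
    (g : ArithCircuit.Gate k (Fin n × Fin n)) (S : Finset (Fin n))
    (h1 : ∀ g ∈ L, g.args ≠ []) (h2 : ∀ g ∈ L, g.fanIn ≤ A)
    (h3 : ∀ (i : ℕ) (g : ArithCircuit.Gate k (Fin n × Fin n)), L[i]? = some g →
      ∀ u ∈ g.args, u.RefsBelow i)
    (h4 : ∀ i, (K i).card ≤ 2)
    (h5 : ∀ (i : ℕ) (us : List (ArithCircuit.Operand k (Fin n × Fin n))),
      L[i]? = some (.prod us) → ∀ u ∈ us, SupportSymm.osupp K u ⊆ K i)
    (h6 : ∀ (i : ℕ) (σ : Equiv.Perm (Fin n)), i < L.length → (∀ x ∈ K i, σ x = x) →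
      rename (fun pq : Fin n × Fin n => (σ pq.1, σ pq.2)) ((ArithCircuit.gateValues L).getD i 0) =
        (ArithCircuit.gateValues L).getD i 0)
    (hg1 : g.args ≠ []) (hg2 : g.fanIn ≤ A) (hg3 : ∀ u ∈ g.args, u.RefsBelow L.length)
    (hS : S.card ≤ 2) (hg5 : ∀ us, g = .prod us → ∀ u ∈ us, SupportSymm.osupp K u ⊆ S)
    (hg6 : ∀ σ : Equiv.Perm (Fin n), (∀ x ∈ S, σ x = x) →
      rename (fun pq : Fin n × Fin n => (σ pq.1, σ pq.2)) (g.eval (ArithCircuit.gateValues L)) =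
        g.eval (ArithCircuit.gateValues L)) :
    (∀ g' ∈ L ++ [g], g'.args ≠ []) ∧ (∀ g' ∈ L ++ [g], g'.fanIn ≤ A) ∧
      (∀ (i : ℕ) (g' : ArithCircuit.Gate k (Fin n × Fin n)), (L ++ [g])[i]? = some g' →
        ∀ u ∈ g'.args, u.RefsBelow i) ∧
      (∀ i, (Function.update K L.length S i).card ≤ 2) ∧
      (∀ (i : ℕ) (us : List (ArithCircuit.Operand k (Fin n × Fin n))),
        (L ++ [g])[i]? = some (.prod us) →
          ∀ u ∈ us, SupportSymm.osupp (Function.update K L.length S) u ⊆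
            Function.update K L.length S i) ∧
      (∀ (i : ℕ) (σ : Equiv.Perm (Fin n)), i < (L ++ [g]).length →
        (∀ x ∈ Function.update K L.length S i, σ x = x) →
          rename (fun pq : Fin n × Fin n => (σ pq.1, σ pq.2))
            ((ArithCircuit.gateValues (L ++ [g])).getD i 0) =
            (ArithCircuit.gateValues (L ++ [g])).getD i 0) := by
  refine ⟨?_, ?_, ?_, ?_, ?_, ?_⟩
  · intro g' hg'
    rw [List.mem_append, List.mem_singleton] at hg'
    rcases hg' with hg' | rfl
    exacts [h1 g' hg', hg1]
  · intro g' hg'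
    rw [List.mem_append, List.mem_singleton] at hg'
    rcases hg' with hg' | rfl
    exacts [h2 g' hg', hg2]
  · intro i g' hg'
    rcases rowScanGates_getElem?_append_singleton hg' with ⟨-, hg'⟩ | ⟨rfl, rfl⟩
    exacts [h3 i g' hg', hg3]
  · intro i
    by_cases hi : i = L.length
    · subst hi
      rwa [Function.update_self]
    · rw [Function.update_of_ne hi]
      exact h4 i
  · intro i us hus u hu
    rcases rowScanGates_getElem?_append_singleton hus with ⟨hi, hus⟩ | ⟨rfl, hgus⟩
    · rw [Function.update_of_ne (Nat.ne_of_lt hi), rowScanGates_osupp_update K L.length S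
        (rowScanGates_refsBelow_mono (h3 i _ hus u hu) hi.le)]
      exact h5 i us hus u hu
    · rw [Function.update_self, rowScanGates_osupp_update K L.length S (hg3 u (hgus ▸ hu))]
      exact hg5 us hgus.symm u hu
  · intro i σ hi hσ
    rcases Nat.lt_succ_iff_lt_or_eq.1 (by simpa using hi) with hi | rfl
    · rw [Function.update_of_ne (Nat.ne_of_lt hi)] at hσ
      rw [rowScanGates_getD_eq_of_prefix (List.prefix_append L [g]) hi]
      exact h6 i σ hi hσ
    · rw [Function.update_self] at hσ
      rw [(rowScanGates_append L K g S).2.2.2.2.2]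
      exact hg6 σ hσ

/-- **Hereditary extension.** If ALL operands of the new gate are supported inside `S`, its
value is automatically invariant under the renamings fixing `S` pointwise, so the six hypotheses
pass to `(L ++ [g], K[|L| ↦ S])`. [folklore] -/
theorem rowScanGates_step_hered {k : Type*} [CommSemiring k] {n : ℕ} (A : ℕ)
    (L : List (ArithCircuit.Gate k (Fin n × Fin n))) (K : ℕ → Finset (Fin n))
    (g : ArithCircuit.Gate k (Fin n × Fin n)) (S : Finset (Fin n))
    (h1 : ∀ g ∈ L, g.args ≠ []) (h2 : ∀ g ∈ L, g.fanIn ≤ A)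
    (h3 : ∀ (i : ℕ) (g : ArithCircuit.Gate k (Fin n × Fin n)), L[i]? = some g →
      ∀ u ∈ g.args, u.RefsBelow i)
    (h4 : ∀ i, (K i).card ≤ 2)
    (h5 : ∀ (i : ℕ) (us : List (ArithCircuit.Operand k (Fin n × Fin n))),
      L[i]? = some (.prod us) → ∀ u ∈ us, SupportSymm.osupp K u ⊆ K i)
    (h6 : ∀ (i : ℕ) (σ : Equiv.Perm (Fin n)), i < L.length → (∀ x ∈ K i, σ x = x) →
      rename (fun pq : Fin n × Fin n => (σ pq.1, σ pq.2)) ((ArithCircuit.gateValues L).getD i 0) =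
        (ArithCircuit.gateValues L).getD i 0)
    (hg1 : g.args ≠ []) (hg2 : g.fanIn ≤ A) (hg3 : ∀ u ∈ g.args, u.RefsBelow L.length)
    (hS : S.card ≤ 2) (hg4 : ∀ u ∈ g.args, SupportSymm.osupp K u ⊆ S) :
    (∀ g' ∈ L ++ [g], g'.args ≠ []) ∧ (∀ g' ∈ L ++ [g], g'.fanIn ≤ A) ∧
      (∀ (i : ℕ) (g' : ArithCircuit.Gate k (Fin n × Fin n)), (L ++ [g])[i]? = some g' →
        ∀ u ∈ g'.args, u.RefsBelow i) ∧
      (∀ i, (Function.update K L.length S i).card ≤ 2) ∧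
      (∀ (i : ℕ) (us : List (ArithCircuit.Operand k (Fin n × Fin n))),
        (L ++ [g])[i]? = some (.prod us) →
          ∀ u ∈ us, SupportSymm.osupp (Function.update K L.length S) u ⊆
            Function.update K L.length S i) ∧
      (∀ (i : ℕ) (σ : Equiv.Perm (Fin n)), i < (L ++ [g]).length →
        (∀ x ∈ Function.update K L.length S i, σ x = x) →
          rename (fun pq : Fin n × Fin n => (σ pq.1, σ pq.2))
            ((ArithCircuit.gateValues (L ++ [g])).getD i 0) =
            (ArithCircuit.gateValues (L ++ [g])).getD i 0) :=
  rowScanGates_step A L K g S h1 h2 h3 h4 h5 h6 hg1 hg2 hg3 hS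
    (fun _ hus u hu => hg4 u (hus ▸ hu))
    (fun σ hσ => rowScanGates_gate_rename _ _ g fun u hu =>
      rowScanGates_operand_rename L K h6 (hg3 u hu) (hg4 u hu) σ hσ)

/-! ### Iterating a one-task construction -/

/-- **Iteration.** If, starting from any extension `(L', K')` of `(L, K)` satisfying the
invariant `Inv`, task `x` can be performed by appending at most `cost` gates — keeping `Inv`, the
earlier gates and annotations, and LOCATING a family of values `v x y` at supports `S x y` —
then all tasks `x : ι` can be performed by appending at most `|ι| · cost` gates. Located values
persist because the earlier gates and annotations are kept. [folklore] -/
theorem rowScanGates_iter {k : Type*} [CommSemiring k] {σ κ ι β : Type*} [Fintype ι]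
    (Inv : List (ArithCircuit.Gate k σ) → (ℕ → κ) → Prop) (S : ι → β → κ)
    (v : ι → β → MvPolynomial σ k) (cost : ℕ) (L : List (ArithCircuit.Gate k σ)) (K : ℕ → κ)
    (hstep : ∀ (x : ι) (L' : List (ArithCircuit.Gate k σ)) (K' : ℕ → κ), L <+: L' →
      (∀ t < L.length, K' t = K t) → Inv L' K' →
      ∃ (L'' : List (ArithCircuit.Gate k σ)) (K'' : ℕ → κ), L' <+: L'' ∧
        (∀ t < L'.length, K'' t = K' t) ∧ L''.length ≤ L'.length + cost ∧ Inv L'' K'' ∧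
        ∀ y : β, ∃ t < L''.length, K'' t = S x y ∧ (ArithCircuit.gateValues L'').getD t 0 = v x y)
    (hInv : Inv L K) :
    ∃ (L' : List (ArithCircuit.Gate k σ)) (K' : ℕ → κ), L <+: L' ∧ (∀ t < L.length, K' t = K t) ∧
      L'.length ≤ L.length + Fintype.card ι * cost ∧ Inv L' K' ∧
      ∀ (x : ι) (y : β), ∃ t < L'.length, K' t = S x y ∧
        (ArithCircuit.gateValues L').getD t 0 = v x y := by
  classical
  suffices H : ∀ s : Finset ι, ∃ (L' : List (ArithCircuit.Gate k σ)) (K' : ℕ → κ), L <+: L' ∧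
      (∀ t < L.length, K' t = K t) ∧ L'.length ≤ L.length + s.card * cost ∧ Inv L' K' ∧
      ∀ x ∈ s, ∀ y : β, ∃ t < L'.length, K' t = S x y ∧
        (ArithCircuit.gateValues L').getD t 0 = v x y by
    obtain ⟨L', K', h₁, h₂, h₃, h₄, h₅⟩ := H Finset.univ
    exact ⟨L', K', h₁, h₂, by rwa [Finset.card_univ] at h₃, h₄,
      fun x y => h₅ x (Finset.mem_univ x) y⟩
  intro s
  induction s using Finset.induction_on with
  | empty =>
    exact ⟨L, K, List.prefix_rfl, fun t _ => rfl, by simp, hInv,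
      fun x hx => absurd hx (Finset.notMem_empty x)⟩
  | insert a s ha ih =>
    obtain ⟨L₁, K₁, hpre₁, hagr₁, hlen₁, hInv₁, hfact₁⟩ := ih
    obtain ⟨L₂, K₂, hpre₂, hagr₂, hlen₂, hInv₂, hfact₂⟩ := hstep a L₁ K₁ hpre₁ hagr₁ hInv₁
    refine ⟨L₂, K₂, hpre₁.trans hpre₂, fun t ht => ?_, ?_, hInv₂, ?_⟩
    · rw [hagr₂ t (lt_of_lt_of_le ht hpre₁.length_le), hagr₁ t ht]
    · rw [Finset.card_insert_of_notMem ha, Nat.succ_mul]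
      omega
    · intro x hx y
      rw [Finset.mem_insert] at hx
      rcases hx with rfl | hx
      · exact hfact₂ y
      · obtain ⟨t, ht, hK, hv⟩ := hfact₁ x hx y
        exact ⟨t, lt_of_lt_of_le ht hpre₂.length_le, by rw [hagr₂ t ht, hK],
          by rw [rowScanGates_getD_eq_of_prefix hpre₂ ht, hv]⟩

end Summit.ValiantsHypothesis.ValiantsHypothesis.Theorems
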